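import Summits.CriticalPhenomena.PercolationContinuityZ3.Theorems.Transplant.KNCellsBoxProdZ2
import Summits.CriticalPhenomena.PercolationContinuityZ3.Theorems.Transplant.KNCells2Cover
import Summits.CriticalPhenomena.PercolationContinuityZ3.Theorems.Transplant.KNLevelsStepIII
import HarnessLib

/-!
# The `X □ ℤ²` anchored cell geometry WITH A FIBRE-RADII RECORD (lag-1 anchors, p2-g2 F8-DESIGN §7): `cellGeomR X C ϱ a₀ anchor hanch` with
# clamp radius `ϱ.anch`, target-cube radius `ϱ.M`, tube radius `ϱ.T` (Btw / E^far / stubs / zones / faces / corridor), cube radius `ϱ.Q`, cell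
# radius `ϱ.C`, and the geometry hypotheses of the single target `samePWitnessAt_of_kit₂'`: `RunGeom`, `AnchGeom`, `SepGeom₂`, `ExitGeom`, `StepsGeom`

builds on p205010 (kernel theorem, internal audit signed; external expert review pending) — nothing in this file uses p205010.
Lane `prim-bschramm`, seat `prim-bschramm-p3`; helper file (`--supports stmt-CriticalPhenomena-4575 --as helper`).  Generalises `KNCellsBoxProdZ2`
(`cellGeom` = the case `anch = M = T = R`, `Q = 2R`, `C = 3R`).

The structure fields force one tube radius: `Face/Stub/Hfull` share a fibre radius (`LevelGeom.mem_Stub/mem_Face`, `StepsGeom`), `E^far ⊆ Btw ∪ Q`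
(same anchor) and `Hfull_{a'} ⊆ Q_a ∪ E^far_{a'}` (`a' ∈ anchSet a v`); so the radii record is `ϱ = (anch, M, T, Q, C)` with
`ϱ.Ordered : M ≤ T ∧ anch + T ≤ Q ∧ anch + Q ≤ C`.  Sets: `M a v = B(a, M) × M_v`, `Q a v = B(a, Q) × Q_v`, `Cell a v = B(a, C) × Cell_v`,
`Btw/Efar/Stub/Zone a = B(a, T) × (planar box)`, `anchSet a v = B(a, anch)`, root `(a₀, 0)`, column `{y | y.2 = cen x}`.
* `cellGeomR`, `faceDataR` (`Face/Hfull a = B(a, T) × planar`), `runGeomR`, `anchGeomR`, `sepGeomR`, **`sepGeom₂R`**, `exitGeomR`, `stepsGeomR`;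
* the clamped entry anchor `entryAnchorR` (least-`KNLevels.rank` vertex of the slab `B(β, M + anch) × M_x` joined to the root by the seen open
  edges, its fibre coordinate if within `anch` of `β`, else `β`), `entryAnchorR_mem`, `entryCellGeomR`.

[cite: KozmaNitzan2024, §4 pp. 25–27 (Q_v, M_v, E_{v,x}, H^j_{v,x}, the exploration) — the ℤ^d model]
-/

noncomputable section

open scoped Classical

namespace Summit.CriticalPhenomena.PercolationContinuityZ3.Theorems

namespace Transplant

namespace BoxProdZ2

open Literature.Probability.Percolation Literature.Probability.LatticeModels SimpleGraph GadgetSystem Contour KNCells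
open Literature.Probability.Percolation.KozmaNitzan.Cells (oth oth_ne sgOf sgOf_sign stepVec_apply_fst stepVec_apply_oth eq_oth_of_ne)
open Literature.Barriers.CriticalPhenomena (graphBall graphBall_finite mem_graphBall_self graphBall_mono)

variable {W : Type} (X : SimpleGraph W) [X.LocallyFinite]

/-- **Fibre radii** of the `X □ ℤ²` cells: clamp radius of the anchors, target-cube radius, tube radius (between-boxes, far regions, stubs,
zones, faces, corridors), cube radius, cell radius. [this work] -/
structure FibRadii where
  /-- clamp radius: `anchSet a v = B_X(a, anch)` -/
  anch : ℕ
  /-- fibre radius of the target cubes `M` -/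
  M : ℕ
  /-- fibre radius of `Btw`, `E^far`, stubs, zones, faces, corridors -/
  T : ℕ
  /-- fibre radius of the cubes `Q` -/
  Q : ℕ
  /-- fibre radius of the cells -/
  C : ℕ

/-- The order constraints under which the containments of the geometry structures hold. [this work] -/
structure FibRadii.Ordered (ϱ : FibRadii) : Prop where
  M_le_T : ϱ.M ≤ ϱ.T
  anch_T : ϱ.anch + ϱ.T ≤ ϱ.Q
  anch_Q : ϱ.anch + ϱ.Q ≤ ϱ.C

/-- **The anchored cell geometry of `X □ ℤ²` with fibre radii `ϱ`.** [cite: KozmaNitzan2024, §4 pp. 25–26] -/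
def cellGeomR (C : PCells) (ϱ : FibRadii) (a₀ : W) (anchor : W → Site 2 → Finset (Sym2 (W × Site 2)) → W)
    (hanch : ∀ a v P, anchor a v P ∈ ballFin X a ϱ.anch) : CellGeom (W × Site 2) W where
  K := C.K
  root := (a₀, 0)
  a₀ := a₀
  Q := fun a v => ballFin X a ϱ.Q ×ˢ C.Q v
  M := fun a v => ballFin X a ϱ.M ×ˢ C.M v
  Cell := fun a v => ballFin X a ϱ.C ×ˢ C.Cell v
  Btw := fun a v δ => ballFin X a ϱ.T ×ˢ C.Btw v δ
  Efar := fun a v δ => ballFin X a ϱ.T ×ˢ C.Efar v δ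
  Stub := fun a v δ j => ballFin X a ϱ.T ×ˢ C.Stub v δ j
  Zone := fun a v δ => ballFin X a ϱ.T ×ˢ C.Zone v δ
  col := fun x => {y | y.2 = C.cen x}
  anchor := anchor
  anchSet := fun a _ => ballFin X a ϱ.anch
  anchor_mem := fun a v P => hanch a v P
  stub_mono := fun _ v δ _ _ h => Finset.product_subset_product le_rfl (C.Stub_mono v δ h)
  hK := by have := C.hK; omega

/-- **The faces and corridors** with fibre radius `ϱ.T`. [cite: KozmaNitzan2024, §4 p. 26 (H_{v,x}), p. 30 (F^j_{v,x})] -/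
def faceDataR (C : PCells) (ϱ : FibRadii) : FaceData (W × Site 2) W where
  Face := fun a v δ j => ballFin X a ϱ.T ×ˢ C.Face v δ j
  Hfull := fun a v δ => ballFin X a ϱ.T ×ˢ C.Hfull v δ

variable (C : PCells) (ϱ : FibRadii) (a₀ : W) (anchor : W → Site 2 → Finset (Sym2 (W × Site 2)) → W)
  (hanch : ∀ a v P, anchor a v P ∈ ballFin X a ϱ.anch)

/-! ## The structural facts -/

/-- `RunGeom` (planar steps inside the boxes). [folklore] -/
theorem runGeomR : RunGeom (X □ zdGraph 2) (cellGeomR X C ϱ a₀ anchor hanch) where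
  adjQ _ v _ hy := exists_adj_product X (fun _ ht => C.exists_adj_of_mem_Q v ht) hy
  adjBtw _ v δ _ hy := exists_adj_product X (fun _ ht => C.exists_adj_of_mem_Btw v δ ht) hy
  adjStub _ v δ j _ _ hy := exists_adj_product X (fun _ ht => C.exists_adj_of_mem_Stub v δ j ht) hy

/-- `AnchGeom` (the admissible anchors `B(a, anch)` contain `a` and do not depend on the macro-vertex). [folklore] -/
theorem anchGeomR : AnchGeom (cellGeomR X C ϱ a₀ anchor hanch) where
  refl a v := by change a ∈ ballFin X a ϱ.anch; rw [mem_ballFin]; exact mem_graphBall_self X a _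
  const _ _ _ := rfl

/-! ## The clamped entry anchor -/

/-- **The clamped entry anchor** (p2-g2 F8-DESIGN §7): the fibre coordinate of the least-rank vertex of the slab `B(β, M + anch) × M_x` joined to
the root by the open edges seen, if it is within `anch` of `β`; otherwise (and if there is none) `β` itself. [cite: KozmaNitzan2024, §4 p. 27] -/
def entryAnchorR [DecidableEq W] (root : W × Site 2) (β : W) (x : Site 2) (P : Finset (Sym2 (W × Site 2))) : W :=
  if h : ((ballFin X β (ϱ.M + ϱ.anch) ×ˢ C.M x).filter fun y =>
      (SimpleGraph.fromEdgeSet (↑P : Set (Sym2 (W × Site 2)))).Reachable root y).Nonempty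
  then
    (fun w => if w ∈ ballFin X β ϱ.anch then w else β)
      (Classical.choose (Finset.exists_min_image _ (KNLevels.rank (ballFin X β (ϱ.M + ϱ.anch) ×ˢ C.M x)) h)).1
  else β

/-- The clamped entry anchor is admissible. [folklore] -/
theorem entryAnchorR_mem [DecidableEq W] (root : W × Site 2) (β : W) (x : Site 2) (P : Finset (Sym2 (W × Site 2))) :
    entryAnchorR X C ϱ root β x P ∈ ballFin X β ϱ.anch := by
  have hβ : β ∈ ballFin X β ϱ.anch := (mem_ballFin X).2 (mem_graphBall_self X β _)
  unfold entryAnchorR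
  split_ifs with h
  · dsimp only
    split_ifs with hw
    · exact hw
    · exact hβ
  · exact hβ

/-- **The `X □ ℤ²` cell geometry with radii and the clamped entry-anchor rule** (root `(a₀, 0)`). [cite: KozmaNitzan2024, §4 pp. 25–27] -/
def entryCellGeomR [DecidableEq W] : CellGeom (W × Site 2) W :=
  cellGeomR X C ϱ a₀ (entryAnchorR X C ϱ (a₀, 0)) (entryAnchorR_mem X C ϱ (a₀, 0))


variable {ϱ} (hϱ : ϱ.Ordered)
include hϱ

/-- **`SepGeom`** with radii. [cite: KozmaNitzan2024, §4 pp. 25–26] -/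
theorem sepGeomR [DecidableEq W] : SepGeom (X □ zdGraph 2) (cellGeomR X C ϱ a₀ anchor hanch) where
  anch_refl a v := by change a ∈ ballFin X a ϱ.anch; rw [mem_ballFin]; exact mem_graphBall_self X a _
  root_mem := by
    change (a₀, (0 : Site 2)) ∈ ballFin X a₀ ϱ.Q ×ˢ C.Q 0
    exact Finset.mem_product.2 ⟨(mem_ballFin X).2 (mem_graphBall_self X a₀ _), C.zero_mem_Q_zero⟩
  Q_subset_Cell a v := Finset.product_subset_product (ballFin_mono X a (by have := hϱ.anch_Q; omega)) (C.Q_subset_Cell v)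
  Btw_subset_Cells a a' v δ ha' := by
    change ballFin X a' ϱ.T ×ˢ C.Btw v δ ⊆ ballFin X a ϱ.C ×ˢ C.Cell v ∪ ballFin X a' ϱ.C ×ˢ C.Cell (v + stepVec δ)
    exact product_subset_union (ballFin_subset_of_mem X ha' (by have := hϱ.anch_T; have := hϱ.anch_Q; omega))
      (ballFin_mono X a' (by have := hϱ.anch_T; have := hϱ.anch_Q; omega)) (C.Btw_subset_Cells v δ)
  Stub_subset_Q_union_Btw a a' v δ j ha' hj := by
    change ballFin X a' ϱ.T ×ˢ C.Stub v δ j ⊆ ballFin X a ϱ.Q ×ˢ C.Q v ∪ ballFin X a' ϱ.T ×ˢ C.Btw v δ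
    exact product_subset_union (ballFin_subset_of_mem X ha' hϱ.anch_T) le_rfl
      (C.Stub_subset_Q_union_Btw v δ (by change j + 1 ≤ C.K at hj; omega))
  Stub_subset_Cell_union_Zone a a' v δ j ha' hj := by
    change ballFin X a' ϱ.T ×ˢ C.Stub v δ j ⊆ ballFin X a ϱ.C ×ˢ C.Cell v ∪ ballFin X a' ϱ.T ×ˢ C.Zone v δ
    exact product_subset_union (ballFin_subset_of_mem X ha' (by have := hϱ.anch_T; have := hϱ.anch_Q; omega)) le_rfl
      (C.Stub_subset_Cell_union_Zone v δ (by change j + 1 ≤ C.K at hj; omega))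
  Efar_subset_Btw_union_Q a v δ := by
    change ballFin X a ϱ.T ×ˢ C.Efar v δ ⊆ ballFin X a ϱ.T ×ˢ C.Btw v δ ∪ ballFin X a ϱ.Q ×ˢ C.Q (v + stepVec δ)
    exact product_subset_union le_rfl (ballFin_mono X a (by have := hϱ.anch_T; omega)) (C.Efar_subset_Btw_union_Q v δ)
  Ewv_disjoint_Efar a a' w δw du hdu := by
    change Disjoint (ballFin X a ϱ.T ×ˢ C.Btw w δw ∪ ballFin X a ϱ.Q ×ˢ C.Q (w + stepVec δw)) (ballFin X a' ϱ.T ×ˢ C.Efar (w + stepVec δw) du)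
    have h := C.Ewv_disjoint_Efar w hdu
    rw [PCells.Ewv, Finset.disjoint_union_left] at h
    rw [Finset.disjoint_union_left]
    exact ⟨disjoint_product_of_right h.1, disjoint_product_of_right h.2⟩
  Q_disjoint_Q a a' u x hux := disjoint_product_of_right (C.Q_disjoint_Q hux)
  Q_disjoint_Btw a a' x v δ := disjoint_product_of_right (C.Q_disjoint_Btw x v δ)
  Btw_disjoint_Btw a a' v δ v' δ' h1 h2 := disjoint_product_of_right (C.Btw_disjoint_Btw h1 h2)
  Q_disjoint_Efar a a' v δ := disjoint_product_of_right (C.Q_disjoint_Efar v δ)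
  Btw_disjoint_Efar a a' v δ δ' h := disjoint_product_of_right (C.Btw_disjoint_Efar v h)
  col_Q a x := ⟨(a, C.cen x), Finset.mem_product.2 ⟨(mem_ballFin X).2 (mem_graphBall_self X a _), C.cen_mem_Q x⟩, rfl⟩
  col_Cell a u x hux y hy hcol := by
    change y.2 = C.cen x at hcol
    exact C.cen_not_mem_Cell hux (hcol ▸ (Finset.mem_product.1 hy).2)
  col_Zone a u δ x y hy hcol := by
    change y.2 = C.cen x at hcol
    exact C.cen_not_mem_Zone u δ x (hcol ▸ (Finset.mem_product.1 hy).2)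

/-- **`SepGeom₂`** (lag-1 cross-anchor containments): `Q_a ⊆ Cell_{a'}` and `Btw_a ⊆ Cell_a ∪ Cell_{a'}` for `a' ∈ B(a, anch)`.
[cite: KozmaNitzan2024, §4 pp. 25–26] -/
theorem sepGeom₂R [DecidableEq W] : SepGeom₂ (X □ zdGraph 2) (cellGeomR X C ϱ a₀ anchor hanch) where
  toSepGeom := sepGeomR X C a₀ anchor hanch hϱ
  Q_subset_Cell₂ a a' x ha' := by
    change ballFin X a ϱ.Q ×ˢ C.Q x ⊆ ballFin X a' ϱ.C ×ˢ C.Cell x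
    have ha'' : a ∈ ballFin X a' ϱ.anch := by
      have h := (mem_ballFin X).1 ha'
      rw [mem_ballFin]; exact (mem_graphBall_comm X).1 h
    exact Finset.product_subset_product (ballFin_subset_of_mem X ha'' hϱ.anch_Q) (C.Q_subset_Cell x)
  Btw_subset_Cells₂ a a' v δ ha' := by
    change ballFin X a ϱ.T ×ˢ C.Btw v δ ⊆ ballFin X a ϱ.C ×ˢ C.Cell v ∪ ballFin X a' ϱ.C ×ˢ C.Cell (v + stepVec δ)
    have ha'' : a ∈ ballFin X a' ϱ.anch := by
      have h := (mem_ballFin X).1 ha'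
      rw [mem_ballFin]; exact (mem_graphBall_comm X).1 h
    exact product_subset_union (ballFin_mono X a (by have := hϱ.anch_T; have := hϱ.anch_Q; omega))
      (ballFin_subset_of_mem X ha'' (by have := hϱ.anch_T; have := hϱ.anch_Q; omega)) (C.Btw_subset_Cells v δ)

/-- **`ExitGeom`** with radii. [cite: KozmaNitzan2024, §4 pp. 26–27] -/
theorem exitGeomR [DecidableEq W] : ExitGeom (X □ zdGraph 2) (cellGeomR X C ϱ a₀ anchor hanch) where
  M_subset_Q a v := Finset.product_subset_product (ballFin_mono X a (by have := hϱ.M_le_T; have := hϱ.anch_T; omega)) (C.M_subset_Q v)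
  Cell_disjoint_Q a a' u x hux := disjoint_product_of_right (C.Cell_disjoint_Q hux)
  Zone_disjoint_Q a a' u δ x := disjoint_product_of_right (C.Zone_disjoint_Q u δ x)
  locFin y := by
    set B : Site 2 := fun i => |y.2 i| + 35 * C.r + 1 with hB
    refine (Finset.Icc (-B) B).finite_toSet.subset ?_
    rintro v ⟨a, w, δ, rfl, b, hb, hadj⟩
    change b ∈ ballFin X a ϱ.T ×ˢ C.Btw w δ ∪ ballFin X a ϱ.Q ×ˢ C.Q (w + stepVec δ) at hb
    have hb2 : b.2 ∈ C.Ewv w δ := by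
      rw [PCells.Ewv, Finset.mem_union]
      rcases Finset.mem_union.1 hb with h | h
      · exact Or.inl (Finset.mem_product.1 h).2
      · exact Or.inr (Finset.mem_product.1 h).2
    have hnear : ∀ i, |b.2 i - y.2 i| ≤ 1 := by
      intro i
      rcases (boxProd_adj).1 hadj with ⟨-, h2⟩ | ⟨h2, -⟩
      · rw [h2, sub_self, abs_zero]; exact zero_le_one
      · exact abs_sub_comm (b.2 i) (y.2 i) ▸ DCT16.abs_sub_le_one_of_adj h2 i
    rw [Finset.coe_Icc, Set.mem_Icc]
    have key : ∀ i, |(w + stepVec δ) i| ≤ B i := by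
      intro i
      have h1 := sub_cen_le_of_mem_Ewv C hb2 i
      have h2 := hnear i
      rw [abs_le] at h1 h2 ⊢
      simp only [PCells.cen_apply] at h1
      simp only [hB]
      have hy := abs_nonneg (y.2 i)
      have hy' := le_abs_self (y.2 i)
      have hy'' := neg_abs_le (y.2 i)
      have hr : (1 : ℤ) ≤ C.r := by exact_mod_cast C.one_le_r
      constructor <;> nlinarith
    exact ⟨fun i => (abs_le.1 (key i)).1, fun i => (abs_le.1 (key i)).2⟩

/-- **`StepsGeom`** with radii. [cite: KozmaNitzan2024, §4 pp. 26, 30] -/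
theorem stepsGeomR [DecidableEq W] : StepsGeom (cellGeomR X C ϱ a₀ anchor hanch) (faceDataR X C ϱ) where
  Face_subset_Stub a v δ j := Finset.product_subset_product le_rfl (C.Face_subset_Stub v δ j)
  Stub_subset_Hfull a v δ j hj := Finset.product_subset_product le_rfl (C.Stub_subset_Hfull v δ hj)
  Hfull_subset a a' v δ ha' := by
    change ballFin X a' ϱ.T ×ˢ C.Hfull v δ ⊆ ballFin X a ϱ.Q ×ˢ C.Q v ∪ ballFin X a' ϱ.T ×ˢ C.Efar v δ
    exact product_subset_union (ballFin_subset_of_mem X ha' hϱ.anch_T) le_rfl (C.Hfull_subset_Q_union_Efar v δ)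
  M_tgt_subset_Efar a v δ := Finset.product_subset_product (ballFin_mono X a hϱ.M_le_T) (C.M_add_stepVec_subset_Efar v δ)

end BoxProdZ2

end Transplant

end Summit.CriticalPhenomena.PercolationContinuityZ3.Theorems

end
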